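import Mathlib
import HarnessLib
import Summits.ValiantsHypothesis.ValiantsHypothesis.Theorems.MonotoneRestorationOrbitRestorationQPRowColumnTwoLevel
import Summits.ValiantsHypothesis.ValiantsHypothesis.Theorems.MonotoneRestorationOrbitRestorationQPMultisymmetricPowerSums
import Summits.ValiantsHypothesis.ValiantsHypothesis.Theorems.MonotoneRestorationOrbitRestorationQPValueOrbitRestoration
import Summits.ValiantsHypothesis.ValiantsHypothesis.Theorems.MonotoneRestorationOrbitRestorationQPRestorable

/-!
# Orbit sums of bounded-row-support column-symmetric polynomials are orbit-restorable
# (route MonotoneRestoration, crux `OrbitRestorationQP` stmt-ValiantsHypothesis-18293; a certified sub-class of the CRUX beyond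
# depth three, and the `k`-row generalisation of the wreath stratum of line `depth-three-rung`)

Namespace `Summit.ValiantsHypothesis.ValiantsHypothesis.Theorems.MultiRowColumnProducts`.  Definition-free.

Fix `k` rows `g : Fin k → Fin n` of the `n × n` variable matrix.  The MULTI-ROW POWER SUMS of `g` are
`P_α(g) = Σ_b Π_{i<k} x_{g(i) b}^{α i}` (`α : Fin k → ℕ`) — the polarized power sums of the `k × n` submatrix on the rows `g`; by the
first fundamental theorem for multisymmetric functions (`MultisymmetricPowerSums.mem_adjoin_powerSums_of_rowSymmetric_complex`)
every polynomial in that submatrix which is symmetric under permuting its COLUMNS lies in `ℂ[P_α(g) : α]`, e.g. every column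
product `Π_b φ(x_{g(0) b}, …, x_{g(k-1) b})` of a template `φ ∈ ℂ[y_0, …, y_{k-1}]`.  Every `P_α(g)` is the value of a derivation
whose values are supported on `≤ k + 2` indices (the rows `g` and one column), so:

* `multiRowPowerSum_supported` — `P_α(g)` is fixed by the pointwise stabiliser of the rows of `g` and has a `(k+2)`-supported derivation;
* `supported_of_mem_adjoin_multiRowPowerSums` — so does every element of `ℂ[P_α(g) : α]`;
* `qpOrbitRestorable_orbitSum` — **ORBIT SUMS**: if `Φ g ∈ ℂ[P_α(g) : α]` for every `g : Fin k → Fin n` and the family is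
  equivariant (`ren σ (Φ g) = Φ (σ ∘ g)`), then `Σ_g Φ g` is `QPOrbitRestorable (2k + 9) n`
  (`ValueOrbit.qpOrbit_of_supportedDerivation`: symmetry is free in orbit currency);
* `colProduct_mem_adjoin_multiRowPowerSums` — `Π_b φ(x_{g,b}) ∈ ℂ[P_α(g) : α]` for every template `φ`;
* `qpOrbitRestorable_orbitSum_colProducts` — **for every `k`, every template `φ ∈ ℂ[y_0..y_{k-1}]` and every `n`,
  `Σ_{g : Fin k → Fin n} Π_{b<n} φ(x_{g(0)b}, …, x_{g(k-1)b})` is `QPOrbitRestorable (2k + 9) n`;** family form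
  `orbitSum_colProducts_restoration` (templates may depend on the level; one constant `2k + 9`).

Calibration.  `k = 1` is the row-wreath stratum; for AFFINE templates the sums are g7's equivariant normal forms of the affine
column-set-multilinear stratum; for non-affine templates (e.g. `φ = 1 + y_0 y_1`: `Σ_{a,a'} Π_b (1 + x_{ab} x_{a'b})`, the row-pair
common-neighbourhood polynomial) the families are matrix-symmetric `VP` families OUTSIDE the depth-three slice and outside THEOREM δ
(whose scan templates are functions of the power sums of ONE row): new certified instances of the crux `OrbitRestorationQP` itself.
Honest label: a stratum; no stub closed; the crux and VP ≠ VNP untouched. [folklore]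
[cite: Weyl1939, Chap. II §3, Thm (2.3.A); DawarWilsenach2025, §3.3]
-/

noncomputable section

open scoped Classical

-- `Summit.ValiantsHypothesis.ValiantsHypothesis.…` is the tree's single-conjunct layout (Sub = Summit).
set_option linter.dupNamespace false

namespace Summit.ValiantsHypothesis.ValiantsHypothesis.Theorems.MultiRowColumnProducts

open MvPolynomial Equiv Literature.Computability.AlgebraicComplexity OrbitRestorationQPDepthThreeRung
  Summit.ValiantsHypothesis.ValiantsHypothesis.Theorems RowColumnTwoLevel

variable {n : ℕ}

/-! ### Multi-row power sums are supported -/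

/-- A variable has a `K`-supported derivation for every `K ≥ 2` (support `{P.1, P.2}`). [folklore] -/
theorem X_supported_le {K : ℕ} (hK : 2 ≤ K) (P : Fin n × Fin n) :
    ∃ 𝒟 : ValueDerivation ℂ (Fin n × Fin n), (X P : MvPolynomial (Fin n × Fin n) ℂ) ∈ 𝒟.S ∧
      ∀ q ∈ 𝒟.S, ∃ T' : Finset (Fin n), T'.card ≤ K ∧ ∀ σ : Perm (Fin n), (∀ i ∈ T', σ i = i) → ren σ q = q := by
  obtain ⟨𝒟, hmem, hS⟩ := (X_supported (n := n) P).2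
  exact ⟨𝒟, hmem, fun q hq => by obtain ⟨T', hT', h⟩ := hS q hq; exact ⟨T', hT'.trans hK, h⟩⟩

/-- **Multi-row power sums are supported.**  `P_α(g) = Σ_b Π_i x_{g(i) b}^{α i}` is fixed by every permutation fixing the rows of
`g` pointwise, and is the value of a derivation all of whose values are supported on `≤ k + 2` indices. [folklore] -/
theorem multiRowPowerSum_supported {k : ℕ} (g : Fin k → Fin n) (α : Fin k → ℕ) :
    (∀ σ : Perm (Fin n), (∀ i ∈ Finset.univ.image g, σ i = i) →
      ren σ (∑ b : Fin n, ∏ i : Fin k, (X (g i, b) : MvPolynomial (Fin n × Fin n) ℂ) ^ α i) =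
        ∑ b : Fin n, ∏ i : Fin k, (X (g i, b) : MvPolynomial (Fin n × Fin n) ℂ) ^ α i) ∧
    ∃ 𝒟 : ValueDerivation ℂ (Fin n × Fin n),
      (∑ b : Fin n, ∏ i : Fin k, (X (g i, b) : MvPolynomial (Fin n × Fin n) ℂ) ^ α i) ∈ 𝒟.S ∧
      ∀ q ∈ 𝒟.S, ∃ T' : Finset (Fin n), T'.card ≤ k + 2 ∧ ∀ σ : Perm (Fin n), (∀ i ∈ T', σ i = i) → ren σ q = q := by
  have hg_fix : ∀ σ : Perm (Fin n), (∀ i ∈ Finset.univ.image g, σ i = i) → ∀ i : Fin k, σ (g i) = g i :=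
    fun σ hσ i => hσ (g i) (Finset.mem_image_of_mem g (Finset.mem_univ i))
  have hfix : ∀ σ : Perm (Fin n), (∀ i ∈ Finset.univ.image g, σ i = i) →
      ren σ (∑ b : Fin n, ∏ i : Fin k, (X (g i, b) : MvPolynomial (Fin n × Fin n) ℂ) ^ α i) =
        ∑ b : Fin n, ∏ i : Fin k, (X (g i, b) : MvPolynomial (Fin n × Fin n) ℂ) ^ α i := by
    intro σ hσ
    rw [map_sum]
    simp only [map_prod, map_pow, ren_X, Prod.smul_mk, Perm.smul_def, hg_fix σ hσ]
    exact Equiv.sum_comp σ (fun b => ∏ i : Fin k, (X (g i, b) : MvPolynomial (Fin n × Fin n) ℂ) ^ α i)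
  refine ⟨hfix, ?_⟩
  have hcard : (Finset.univ.image g).card ≤ k + 2 :=
    (Finset.card_image_le.trans (by rw [Finset.card_univ, Fintype.card_fin])).trans (by omega)
  refine exists_supported_sum (k := k + 2) Finset.univ
    (fun b => ∏ i : Fin k, (X (g i, b) : MvPolynomial (Fin n × Fin n) ℂ) ^ α i) (fun b _ => ?_)
    (Finset.univ.image g) hcard hfix
  -- the summand of column `b` lies in `ℂ[x_{g(i) b} : i]`, supported on the rows of `g` and the column `b`
  have hA : (insert b (Finset.univ.image g)).card ≤ k + 2 := by
    refine (Finset.card_insert_le _ _).trans ?_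
    have := Finset.card_image_le (s := (Finset.univ : Finset (Fin k))) (f := g)
    rw [Finset.card_univ, Fintype.card_fin] at this
    omega
  have h := exists_supported_of_mem_adjoin (k := k + 2) (insert b (Finset.univ.image g)) hA
    (T := Set.range fun i : Fin k => (X (g i, b) : MvPolynomial (Fin n × Fin n) ℂ))
    (by
      rintro _ ⟨i, rfl⟩
      refine ⟨fun σ hσ => ?_, X_supported_le (by omega) (g i, b)⟩
      have h1 : σ (g i) = g i := hσ _ (Finset.mem_insert_of_mem (Finset.mem_image_of_mem g (Finset.mem_univ i)))
      have h2 : σ b = b := hσ _ (Finset.mem_insert_self _ _)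
      rw [ren_X]
      exact congrArg X (Prod.ext h1 h2))
    (p := ∏ i : Fin k, (X (g i, b) : MvPolynomial (Fin n × Fin n) ℂ) ^ α i)
    (Subalgebra.prod_mem _ fun i _ => Subalgebra.pow_mem _ (Algebra.subset_adjoin (Set.mem_range_self i)) _)
  exact h.2

/-- **Polynomials in the multi-row power sums of `g` are supported** (and fixed by the pointwise stabiliser of the rows of `g`).
[folklore] -/
theorem supported_of_mem_adjoin_multiRowPowerSums {k : ℕ} (g : Fin k → Fin n) {p : MvPolynomial (Fin n × Fin n) ℂ}
    (hp : p ∈ Algebra.adjoin ℂ (Set.range fun α : Fin k → ℕ =>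
      ∑ b : Fin n, ∏ i : Fin k, (X (g i, b) : MvPolynomial (Fin n × Fin n) ℂ) ^ α i)) :
    (∀ σ : Perm (Fin n), (∀ i ∈ Finset.univ.image g, σ i = i) → ren σ p = p) ∧
    ∃ 𝒟 : ValueDerivation ℂ (Fin n × Fin n), p ∈ 𝒟.S ∧
      ∀ q ∈ 𝒟.S, ∃ T' : Finset (Fin n), T'.card ≤ k + 2 ∧ ∀ σ : Perm (Fin n), (∀ i ∈ T', σ i = i) → ren σ q = q := by
  have hcard : (Finset.univ.image g).card ≤ k + 2 :=
    (Finset.card_image_le.trans (by rw [Finset.card_univ, Fintype.card_fin])).trans (by omega)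
  exact exists_supported_of_mem_adjoin (k := k + 2) (Finset.univ.image g) hcard
    (T := Set.range fun α : Fin k → ℕ => ∑ b : Fin n, ∏ i : Fin k, (X (g i, b) : MvPolynomial (Fin n × Fin n) ℂ) ^ α i)
    (by rintro _ ⟨α, rfl⟩; exact multiRowPowerSum_supported g α) hp

/-! ### Orbit sums -/

/-- `(n+1)^m ≤ 2^((log₂ n + (m+1))^(m+1))`. [folklore] -/
theorem succ_pow_le_bound (n m : ℕ) : (n + 1) ^ m ≤ 2 ^ ((Nat.log 2 n + (m + 1)) ^ (m + 1)) := by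
  rcases Nat.eq_zero_or_pos m with rfl | hm
  · rw [pow_zero]; exact Nat.one_le_two_pow
  have hL : n < 2 ^ (Nat.log 2 n + 1) := Nat.lt_pow_succ_log_self Nat.one_lt_two n
  generalize Nat.log 2 n = L at hL ⊢
  have h1 : n + 1 ≤ 2 ^ (L + 1) := hL
  calc (n + 1) ^ m ≤ (2 ^ (L + 1)) ^ m := Nat.pow_le_pow_left h1 m
    _ = 2 ^ (m * (L + 1)) := by rw [← pow_mul, mul_comm]
    _ ≤ 2 ^ ((L + (m + 1)) ^ (m + 1)) := by
        refine Nat.pow_le_pow_right (by norm_num) ?_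
        calc m * (L + 1) ≤ (L + (m + 1)) * (L + (m + 1)) := by nlinarith
          _ = (L + (m + 1)) ^ 2 := (sq _).symm
          _ ≤ (L + (m + 1)) ^ (m + 1) := Nat.pow_le_pow_right (by omega) (by omega)

/-- **ORBIT SUMS OF MULTI-ROW COLUMN-SYMMETRIC POLYNOMIALS ARE RESTORABLE.**  Let `Φ g ∈ ℂ[P_α(g) : α]` for every
`g : Fin k → Fin n`, equivariantly: `ren σ (Φ g) = Φ (σ ∘ g)`.  Then `Σ_g Φ g` is `QPOrbitRestorable (2k + 9) n`. [folklore] -/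
theorem qpOrbitRestorable_orbitSum {k : ℕ} (Φ : (Fin k → Fin n) → MvPolynomial (Fin n × Fin n) ℂ)
    (hmem : ∀ g, Φ g ∈ Algebra.adjoin ℂ (Set.range fun α : Fin k → ℕ =>
      ∑ b : Fin n, ∏ i : Fin k, (X (g i, b) : MvPolynomial (Fin n × Fin n) ℂ) ^ α i))
    (heq : ∀ (σ : Perm (Fin n)) (g : Fin k → Fin n), ren σ (Φ g) = Φ (σ ∘ g)) :
    QPOrbitRestorable (2 * k + 9) n (∑ g : Fin k → Fin n, Φ g) := by
  have hfix : ∀ σ : Perm (Fin n), ren σ (∑ g : Fin k → Fin n, Φ g) = ∑ g : Fin k → Fin n, Φ g := by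
    intro σ
    rw [map_sum]
    simp only [heq]
    exact Fintype.sum_equiv ((Equiv.refl (Fin k)).arrowCongr (σ : Fin n ≃ Fin n)) (fun g => Φ (σ ∘ g)) Φ
      (fun g => rfl)
  have hsupp : ∀ g ∈ (Finset.univ : Finset (Fin k → Fin n)), ∃ 𝒟 : ValueDerivation ℂ (Fin n × Fin n), Φ g ∈ 𝒟.S ∧
      ∀ q ∈ 𝒟.S, ∃ T' : Finset (Fin n), T'.card ≤ k + 2 ∧ ∀ σ : Perm (Fin n), (∀ i ∈ T', σ i = i) → ren σ q = q :=
    fun g _ => (supported_of_mem_adjoin_multiRowPowerSums g (hmem g)).2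
  obtain ⟨𝒟, hmemD, hS⟩ := exists_supported_sum (k := k + 2) Finset.univ Φ hsupp ∅ (by simp) (fun σ _ => hfix σ)
  obtain ⟨G, inst, C, hC, hev, horb⟩ := ValueOrbit.qpOrbit_of_supportedDerivation 𝒟 hmemD hfix hS
  refine ⟨G, inst, C, hC, hev, horb.trans ?_⟩
  have h1 : (n + 1) ^ (2 * (k + 2) + 4) = (n + 1) ^ (2 * k + 8) := by ring_nf
  have h2 := succ_pow_le_bound n (2 * k + 8)
  have h3 : 2 * k + 8 + 1 = 2 * k + 9 := by omega
  rw [h3] at h2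
  rw [h1]
  exact h2

/-! ### Column products of a `k`-row template -/

/-- **Column products of a template lie in the multi-row power-sum algebra**: for `φ ∈ ℂ[y_0, …, y_{k-1}]`,
`Π_b φ(x_{g(0) b}, …, x_{g(k-1) b}) ∈ ℂ[P_α(g) : α]` (first fundamental theorem of multisymmetric functions, transported along
`X (b, i) ↦ x_{g(i) b}`). [cite: Weyl1939, Chap. II §3, Thm (2.3.A)] -/
theorem colProduct_mem_adjoin_multiRowPowerSums {k : ℕ} (g : Fin k → Fin n) (φ : MvPolynomial (Fin k) ℂ) :
    (∏ b : Fin n, aeval (fun i : Fin k => (X (g i, b) : MvPolynomial (Fin n × Fin n) ℂ)) φ) ∈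
      Algebra.adjoin ℂ (Set.range fun α : Fin k → ℕ =>
        ∑ b : Fin n, ∏ i : Fin k, (X (g i, b) : MvPolynomial (Fin n × Fin n) ℂ) ^ α i) := by
  -- the abstract column-symmetric polynomial on the `n × k` pattern
  set Q : MvPolynomial (Fin n × Fin k) ℂ := ∏ b : Fin n, rename (fun i : Fin k => (b, i)) φ with hQ
  have hQsym : ∀ σ : Perm (Fin n), rename (fun w : Fin n × Fin k => (σ w.1, w.2)) Q = Q := by
    intro σ
    rw [hQ, map_prod]
    simp only [rename_rename]
    exact Equiv.prod_comp σ (fun b => rename (fun i : Fin k => (b, i)) φ)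
  have hQmem := MultisymmetricPowerSums.mem_adjoin_powerSums_of_rowSymmetric_complex Q hQsym
  -- transport along `X (b, i) ↦ x_{g(i) b}`
  set ψ : MvPolynomial (Fin n × Fin k) ℂ →ₐ[ℂ] MvPolynomial (Fin n × Fin n) ℂ :=
    aeval fun w : Fin n × Fin k => (X (g w.2, w.1) : MvPolynomial (Fin n × Fin n) ℂ) with hψ
  have hψQ : ψ Q = ∏ b : Fin n, aeval (fun i : Fin k => (X (g i, b) : MvPolynomial (Fin n × Fin n) ℂ)) φ := by
    rw [hQ, map_prod]
    refine Finset.prod_congr rfl fun b _ => ?_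
    rw [hψ, aeval_rename]
    rfl
  have hψgen : ψ '' (Set.range fun α : Fin k → ℕ => ∑ b : Fin n, ∏ i : Fin k, (X (b, i) : MvPolynomial (Fin n × Fin k) ℂ) ^ α i) =
      Set.range fun α : Fin k → ℕ => ∑ b : Fin n, ∏ i : Fin k, (X (g i, b) : MvPolynomial (Fin n × Fin n) ℂ) ^ α i := by
    rw [← Set.range_comp]
    refine congrArg Set.range (funext fun α => ?_)
    simp only [Function.comp_apply, map_sum, map_prod, map_pow, hψ, aeval_X]
  rw [← hψQ, ← hψgen, Algebra.adjoin_image]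
  exact Subalgebra.mem_map.mpr ⟨Q, hQmem, rfl⟩

/-- **ORBIT SUMS OF COLUMN PRODUCTS OF A `k`-ROW TEMPLATE ARE RESTORABLE.**  For every `k`, every template
`φ ∈ ℂ[y_0, …, y_{k-1}]` and every `n`, `Σ_{g : Fin k → Fin n} Π_{b<n} φ(x_{g(0)b}, …, x_{g(k-1)b})` is
`QPOrbitRestorable (2k + 9) n`. [folklore] -/
theorem qpOrbitRestorable_orbitSum_colProducts (k : ℕ) (φ : MvPolynomial (Fin k) ℂ) (n : ℕ) :
    QPOrbitRestorable (2 * k + 9) n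
      (∑ g : Fin k → Fin n, ∏ b : Fin n, aeval (fun i : Fin k => (X (g i, b) : MvPolynomial (Fin n × Fin n) ℂ)) φ) := by
  refine qpOrbitRestorable_orbitSum (fun g => ∏ b : Fin n, aeval (fun i : Fin k => (X (g i, b) : MvPolynomial (Fin n × Fin n) ℂ)) φ)
    (fun g => colProduct_mem_adjoin_multiRowPowerSums g φ) fun σ g => ?_
  rw [map_prod]
  have hren : ∀ b : Fin n, ren σ (aeval (fun i : Fin k => (X (g i, b) : MvPolynomial (Fin n × Fin n) ℂ)) φ) =
      aeval (fun i : Fin k => (X ((σ ∘ g) i, σ b) : MvPolynomial (Fin n × Fin n) ℂ)) φ := by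
    intro b
    rw [show ren σ (aeval (fun i : Fin k => (X (g i, b) : MvPolynomial (Fin n × Fin n) ℂ)) φ) =
      ((ren σ).comp (aeval fun i : Fin k => (X (g i, b) : MvPolynomial (Fin n × Fin n) ℂ))) φ from rfl, comp_aeval]
    have hf : (fun i : Fin k => (ren σ) (X (g i, b) : MvPolynomial (Fin n × Fin n) ℂ)) =
        fun i : Fin k => (X ((σ ∘ g) i, σ b) : MvPolynomial (Fin n × Fin n) ℂ) := by
      funext i
      simp only [ren_X, Prod.smul_mk, Perm.smul_def, Function.comp_apply]
    rw [hf]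
  simp only [hren]
  exact Equiv.prod_comp σ (fun b => aeval (fun i : Fin k => (X ((σ ∘ g) i, b) : MvPolynomial (Fin n × Fin n) ℂ)) φ)

/-- **Family form.**  For every `k` and every sequence of templates `φ_n ∈ ℂ[y_0, …, y_{k-1}]`, the matrix-symmetric family
`f n = Σ_{g : Fin k → Fin n} Π_b φ_n(x_{g,b})` is quasi-polynomially orbit-restorable with the one constant `2k + 9`. [folklore] -/
theorem orbitSum_colProducts_restoration (k : ℕ) (φ : (n : ℕ) → MvPolynomial (Fin k) ℂ) :
    ∃ c : ℕ, ∀ n : ℕ, QPOrbitRestorable c n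
      (∑ g : Fin k → Fin n, ∏ b : Fin n, aeval (fun i : Fin k => (X (g i, b) : MvPolynomial (Fin n × Fin n) ℂ)) (φ n)) :=
  ⟨2 * k + 9, fun n => qpOrbitRestorable_orbitSum_colProducts k (φ n) n⟩

end Summit.ValiantsHypothesis.ValiantsHypothesis.Theorems.MultiRowColumnProducts

end
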